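import Summits.AtomisticToContinuum.HydrodynamicLimit.Theses.LambertianContactSwap
import Summits.AtomisticToContinuum.HydrodynamicLimit.Theorems.LambertianContactSwapLambertianEulerHeartsLog
import HarnessLib

/-!
# The deciding theorem of route `LambertianContactSwap`, re-glued on the PACKING-GUARDED child `LambertianEulerInBand`
# (crux `LambertianContactSwap.LambertianEuler`, stmt-AtomisticToContinuum-11854; crux-strategist decomposition)

Support file (`--supports stmt-AtomisticToContinuum-11854`).  The crux `LambertianEuler` (Euler for the Lambertian gas `Λ`,
UNGUARDED: every classical hs-Euler solution on `[0,T)`) splits as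
`LambertianEulerInBand → ImplosionDichotomy.DiluteSelfConsistency → LambertianEuler`
(`…LambertianEulerInBandOfHearts.lambertianEuler_of_inBand`, line lead c7, p138618), where the guarded child
`…HeartsLog.LambertianEulerInBand` (`∃ η₀ > 0` outermost, packing guard `∀ t ∈ Ico 0 T, ∀ x, ρ t x * σ ^ 3 < η₀` after the
Euler solution — the shape of the re-typed conjunct `_root_.HydrodynamicLimit`, D-0032) carries the research content, and the
second child (stmt-3091) is rated expected-false by its own chain (`DiluteSelfConsistency ↔ ¬ DenseExcursion`,
`Theorems/DenseExcursion/Negative/Dichotomy.lean`).  THIS FILE CERTIFIES THAT THE SECOND CHILD IS NOT LOAD-BEARING FOR THE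
SUB-PROBLEM: `hydrodynamicLimit_of_swapGap_of_inBand : SwapGap → LambertianEulerInBand → _root_.HydrodynamicLimit`, i.e. the
route's deciding theorem `closes (hS : SwapGap) (hL : LambertianEuler)` with its second hypothesis WEAKENED to the guarded child
and the packing threshold `η₀ := η_Λ` (the child's band) instead of `1`.  A tenure planner can therefore re-point `closes` at the
child (`closes hS hL := hydrodynamicLimit_of_swapGap_of_inBand hS hL`; the route decl of the child unfolds to
`…HeartsLog.LambertianEulerInBand` by `Iff.rfl`) and drop the expected-false leaf, losing nothing.

Implementation.  `SwapGap` is written over the inline `let` block (`lflow`, `noise`, …) of the route file, the child over the named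
Λ-API (`lambertFlow`, `lambertNoise`; definitionally equal).  Unifying the two AFTER the `let`s have been zeta-expanded by
application (`hS a₀ …`) exceeds the default heartbeat budget, so §1 states the guarded child once more over the SAME inline `let`
block (`LambertianEulerInBandInline`, byte-identical prefix, so its Λ-terms match `SwapGap`'s syntactically after zeta-reduction —
the device of the route's own `closes`/`MergingTransfer`) and bridges named → inline in the cheap direction (`delta; intro` the
`let`s, one `exact`: the pattern of `…EntropyToHydro.stub_entropyToHydroLambda`, p106285); §2 is the route's certified Portmanteau /
Markov transfer (`closes`, rev 8, Theses/LambertianContactSwap.lean:520–686) verbatim except three marked lines — the guard `hη`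
is now CONSUMED by the child instead of discarded.  Seat planner-cstrat-stmt-AtomisticToContinuum-11854-s1-0, 2026-08-17.
[cite: Billingsley1999, Thm 2.1] [cite: OllaVaradhanYau1993, §1] [cite: Yau1991, §2]
-/

noncomputable section

namespace Summit.AtomisticToContinuum.HydrodynamicLimit.Theorems.LambertianContactSwapLambertianEulerInBandCloses

open scoped BigOperators Topology Manifold Classical MeasureTheory ProbabilityTheory Matrix InnerProductSpace ComplexConjugate ContinuousMap
open Filter Set Function TopologicalSpace MeasureTheory
open Summit.AtomisticToContinuum.HydrodynamicLimit.Theses.LambertianContactSwap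
open Summit.AtomisticToContinuum.HydrodynamicLimit.Theorems.LambertianContactSwapLambertianEulerHeartsLog (LambertianEulerInBand)

/-! ## §1 The guarded child over the route's inline `let` block, and the bridge from the named form -/

/-- `LambertianEulerInBand` (the packing-guarded Euler limit of the Lambertian gas, `∃ η₀ > 0` outermost) written over the
route file's inline `let` block — the body of the crux `LambertianContactSwap.LambertianEuler` with `∃ η₀ : ℝ, 0 < η₀ ∧` inserted
before the profiles and the guard `(∀ t ∈ Set.Ico 0 T, ∀ x, ρ t x * σ ^ 3 < η₀) →` after the Euler solution, nothing else changed.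
An auxiliary restatement (equivalent to `…HeartsLog.LambertianEulerInBand`: `inline_of_named` and `named_of_inline`); OPEN research
statement of the line, not a published fact. -/
def LambertianEulerInBandInline : Prop :=
  let Cfg : ℕ → Type := fun N => Literature.Analysis.FluidPDE.Config (N + 1) (Fin 3) (UnitAddTorus (Fin 3)); let G := Literature.Analysis.FluidPDE.Torus.geometry (Fin 3); let ε : ℝ → ℕ → ℝ := Literature.MathematicalPhysics.KineticTheory.hsDiameter; let τ : ℝ → (N : ℕ) → Cfg N → ENNReal := fun σ N z => Literature.Analysis.FluidPDE.Alexander.freeExitTime G (ε σ N) z; let S : ℝ → (N : ℕ) → Cfg N → Cfg N := fun t _ z => Literature.Analysis.FluidPDE.freeFlight G t z; let ldir : EuclideanSpace ℝ (Fin 3) → EuclideanSpace ℝ (Fin 3) → EuclideanSpace ℝ (Fin 3) := fun ω ξ => ‖‖ω‖⁻¹ • ω + ‖ξ‖⁻¹ • ξ‖⁻¹ • (‖ω‖⁻¹ • ω + ‖ξ‖⁻¹ • ξ); let lpair : (N : ℕ) → Fin (N + 1) → Fin (N + 1) → Cfg N → EuclideanSpace ℝ (Fin 3) → Cfg N :=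 fun _ i j z ξ => let c := (2 : ℝ)⁻¹ • ((z i).2 + (z j).2); let w := (‖(z i).2 - (z j).2‖ / 2) • ldir (G.sepVec (z i).1 (z j).1) ξ; Function.update (Function.update z i ((z i).1, c + w)) j ((z j).1, c - w); let lstep : ℝ → (N : ℕ) → EuclideanSpace ℝ (Fin 3) → Cfg N → Cfg N := fun σ N ξ z => let z' := S (τ σ N z).toReal N z; if τ σ N z = ⊤ then z else if h : (Literature.Analysis.FluidPDE.Alexander.incomingPairs G (ε σ N) z').Nonempty then lpair N h.some.1 h.some.2 z' ξ else z'; let lstate : ℝ → (N : ℕ) → (ℕ → EuclideanSpace ℝ (Fin 3)) → Cfg N → ℕ → Cfg N := fun σ N ξs z k => ((fun p : Cfg N × ℕ => (lstep σ N (ξs p.2) p.1, p.2 + 1))^[k] (z, 0)).1; let linst : ℝ → (N : ℕ) → (ℕ → EuclideanSpace ℝ (Fin 3)) → Cfg N → ℕ → ENNReal := fun σ N ξs z k => ∑ m ∈ Finset.range k, τ σ N (lstate σ N ξs z m); let lflow : ℝ → (N : ℕ) → (ℕ → EuclideanSpace ℝ (Fin 3)) → Cfg N → ℝ → Cfg N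 := fun σ N ξs z t => let K := sSup {k : ℕ | linst σ N ξs z k ≤ ENNReal.ofReal t}; S (t - (linst σ N ξs z K).toReal) N (lstate σ N ξs z K); let noise : MeasureTheory.Measure (ℕ → EuclideanSpace ℝ (Fin 3)) := MeasureTheory.Measure.infinitePi (fun _ : ℕ => ProbabilityTheory.stdGaussian (EuclideanSpace ℝ (Fin 3))); ∃ η₀ : ℝ, 0 < η₀ ∧ ∀ (a₀ θ₀ : (UnitAddTorus (Fin 3)) → ℝ) (u₀ : (UnitAddTorus (Fin 3)) → EuclideanSpace ℝ (Fin 3)), Continuous a₀ → Continuous θ₀ → Continuous u₀ → (∀ x, 0 < a₀ x) → (∀ x, 0 < θ₀ x) → ∃ σ₀ : ℝ, 0 < σ₀ ∧ ∀ σ : ℝ, 0 < σ → σ < σ₀ → ∀ (T : ℝ) (ρ θ : ℝ → (UnitAddTorus (Fin 3)) → ℝ) (u : ℝ → (UnitAddTorus (Fin 3)) → EuclideanSpace ℝ (Fin 3)), Literature.MathematicalPhysics.KineticTheory.IsHardSphereEulerSolution σ T ρ u θ → (∀ t ∈ Set.Ico 0 T, ∀ x, ρ t x * σ ^ 3 <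 η₀) → ∀ Φ : (N : ℕ) → Literature.Analysis.FluidPDE.HardSphereFlow G (ε σ N) (N + 1), let P := fun N => Literature.MathematicalPhysics.KineticTheory.localGibbsLaw σ a₀ u₀ θ₀ N (Φ N); Literature.MathematicalPhysics.KineticTheory.TendstoHydroFieldsAt P Φ ρ u θ 0 → ∀ t ∈ Set.Ico 0 T, ∀ χ : (UnitAddTorus (Fin 3)) → ℝ, Continuous χ → ∀ δ > (0 : ℝ), Filter.Tendsto (fun N : ℕ => ((P N).prod noise) {p | δ < |Literature.MathematicalPhysics.KineticTheory.empiricalDensityField (lflow σ N p.2 p.1 t) χ - ∫ x, χ x * ρ t x|}) Filter.atTop (nhds 0) ∧ Filter.Tendsto (fun N : ℕ => ((P N).prod noise) {p | δ < ‖Literature.MathematicalPhysics.KineticTheory.empiricalMomentumField (lflow σ N p.2 p.1 t) χ - ∫ x, (χ x * ρ t x) • u t x‖}) Filter.atTop (nhds 0) ∧ Filter.Tendsto (fun N : ℕ => ((P N).prod noise) {p | δ < |Literature.MathematicalPhysics.KineticTheory.empiricalEnergyField (lflow σ N p.2 p.1 t) χ - ∫ x, χ x * Literature.MathematicalPhysics.KineticTheory.totalEnergyDensity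 (ρ t x) (u t x) (θ t x)|}) Filter.atTop (nhds 0)

/-- named ⇒ inline: `delta`/`intro` the `let`s and conclude by one `exact` (definitional unfolding of `lambertFlow`, `lambertNoise`
against the `let`-bound `lflow`, `noise`). [folklore] -/
theorem inline_of_named (h : LambertianEulerInBand) : LambertianEulerInBandInline := by
  obtain ⟨η₀, hη₀, H⟩ := h
  delta LambertianEulerInBandInline
  intro Cfg G ε τ S ldir lpair lstep lstate linst lflow noise
  refine ⟨η₀, hη₀, fun a₀ θ₀ u₀ ha hθ hu ha0 hθ0 => ?_⟩
  obtain ⟨σ₀, hσ₀, H⟩ := H a₀ θ₀ u₀ ha hθ hu ha0 hθ0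
  refine ⟨σ₀, hσ₀, fun σ hσ hσ' T ρ θ u hE hg Φ h0 t ht χ hχ δ hδ => ?_⟩
  exact H σ hσ hσ' T ρ θ u hE hg Φ h0 t ht χ hχ δ hδ

/-- inline ⇒ named (so the auxiliary statement is literally equivalent to the child). [folklore] -/
theorem named_of_inline (h : LambertianEulerInBandInline) : LambertianEulerInBand := by
  revert h
  delta LambertianEulerInBandInline
  intro h
  obtain ⟨η₀, hη₀, H⟩ := h
  refine ⟨η₀, hη₀, fun a₀ θ₀ u₀ ha hθ hu ha0 hθ0 => ?_⟩
  obtain ⟨σ₀, hσ₀, H⟩ := H a₀ θ₀ u₀ ha hθ hu ha0 hθ0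
  refine ⟨σ₀, hσ₀, fun σ hσ hσ' T ρ θ u hE hg Φ h0 t ht χ hχ δ hδ => ?_⟩
  exact H σ hσ hσ' T ρ θ u hE hg Φ h0 t ht χ hχ δ hδ

/-! ## §2 The deciding theorem on the guarded child -/

/-- **`SwapGap` + the guarded child (inline form) decide the conjunct.**  Packing threshold `η₀ := η_Λ` (the child's band);
`σ₀ := min σ_S σ_L`; for each of density / momentum / energy and `δ > 0`, with the `1`-Lipschitz cutoff `g = min 1 (max (· − δ/2) 0)`
of the deviation: `min(1,δ/2)·P_N{δ < dev(Φ_t z)} ≤ ∫ g∘dev∘Φ_t dP_N` (Markov; `P_N = localGibbsLaw` is finite for every `σ, N`, the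
deviation is measurable) `= ∫ g∘dev∘Λ_t d(P_N⊗γ^ℕ) + o(1)` (`SwapGap`, test function `g∘|proj − c|`) `≤ (P_N⊗γ^ℕ){δ/2 < dev(Λ_t)} + o(1)`
(`ofReal ∫ ≤ ∫⁻ ofReal ≤` measure of the set) `→ 0` (the guarded child at `δ/2`; the guard is the conjunct's own hypothesis).
Verbatim the route's `closes` (rev 8) except the three lines marked CHANGED. [cite: Billingsley1999, Thm 2.1] [cite: OllaVaradhanYau1993, §1] -/
theorem hydrodynamicLimit_of_swapGap_of_inBandInline (hS : SwapGap) (hL : LambertianEulerInBandInline) :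
    _root_.HydrodynamicLimit := by
  obtain ⟨ηL, hηL, hL⟩ := hL -- CHANGED: the child's band
  refine ⟨ηL, hηL, ?_⟩ -- CHANGED: packing threshold `η₀ := η_Λ` (was `1`, guard discarded)
  intro a₀ θ₀ u₀ ha hθ hu ha0 hθ0
  obtain ⟨σS, hσS, hS'⟩ := hS a₀ θ₀ u₀ ha hθ hu ha0 hθ0
  obtain ⟨σL, hσL, hL'⟩ := hL a₀ θ₀ u₀ ha hθ hu ha0 hθ0
  refine ⟨min σS σL, lt_min hσS hσL, ?_⟩
  intro σ hσ hσlt T ρ θ u hE hη Φ h0 t ht χ hχ δ hδ -- `hη`: the packing guard, now USED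
  have hSw := hS' σ hσ (hσlt.trans_le (min_le_left _ _)) T ρ θ u hE Φ h0 t ht χ hχ
  have hLa := hL' σ hσ (hσlt.trans_le (min_le_right _ _)) T ρ θ u hE hη Φ h0 t ht χ hχ -- CHANGED: guard passed on
  clear hS' hL'
  -- abstract merging transfer: finite `μ n`, measurable real `X n`, arbitrary real `Y n`
  have key : ∀ {α β : ℕ → Type} [∀ n, MeasurableSpace (α n)] [∀ n, MeasurableSpace (β n)]
      (μ : ∀ n, Measure (α n)) (ν : ∀ n, Measure (β n)), (∀ n, IsFiniteMeasure (μ n)) →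
      ∀ (X : ∀ n, α n → ℝ) (Y : ∀ n, β n → ℝ), (∀ n, Measurable (X n)) →
      (∀ g : ℝ → ℝ, LipschitzWith 1 g → (∀ y, |g y| ≤ 1) →
        Tendsto (fun n => (∫ z, g (X n z) ∂μ n) - ∫ p, g (Y n p) ∂ν n) atTop (𝓝 0)) →
      (∀ δ' : ℝ, 0 < δ' → Tendsto (fun n => ν n {p | δ' < Y n p}) atTop (𝓝 0)) →
      ∀ δ' : ℝ, 0 < δ' → Tendsto (fun n => μ n {z | δ' < X n z}) atTop (𝓝 0) := by
    intro α β _ _ μ ν hμ X Y hX hswap hY δ hδ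
    obtain ⟨g, hgl, hga, hg0, hg1, hgz, hgδ⟩ : ∃ g : ℝ → ℝ, LipschitzWith 1 g ∧ (∀ x, |g x| ≤ 1) ∧
        (∀ x, 0 ≤ g x) ∧ (∀ x, g x ≤ 1) ∧ (∀ x, x ≤ δ / 2 → g x = 0) ∧
        (∀ x, δ < x → min 1 (δ / 2) ≤ g x) := by
      have hnn : ∀ x : ℝ, 0 ≤ min 1 (max (x - δ / 2) 0) :=
        fun x => le_min zero_le_one (le_max_right _ _)
      refine ⟨fun x => min 1 (max (x - δ / 2) 0), ?_, ?_, hnn, fun x => min_le_left _ _, ?_, ?_⟩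
      · refine LipschitzWith.mk_one fun x y => ?_
        rw [Real.dist_eq, Real.dist_eq]
        calc |min 1 (max (x - δ / 2) 0) - min 1 (max (y - δ / 2) 0)|
            ≤ max |(1 : ℝ) - 1| |max (x - δ / 2) 0 - max (y - δ / 2) 0| :=
              abs_min_sub_min_le_max _ _ _ _
          _ = |max (x - δ / 2) 0 - max (y - δ / 2) 0| := by
              rw [sub_self, abs_zero, max_eq_right (abs_nonneg _)]
          _ ≤ |x - δ / 2 - (y - δ / 2)| := abs_max_sub_max_le_abs _ _ _
          _ = |x - y| := by rw [sub_sub_sub_cancel_right]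
      · exact fun x => by rw [abs_of_nonneg (hnn x)]; exact min_le_left _ _
      · exact fun x hx => show min 1 (max (x - δ / 2) 0) = 0 by
          rw [max_eq_right (sub_nonpos.2 hx), min_eq_right zero_le_one]
      · exact fun x hx => le_min (min_le_left _ _)
          ((min_le_right _ _).trans (le_max_of_le_left (by linarith)))
    have hκ : 0 < min 1 (δ / 2) := lt_min one_pos (half_pos hδ)
    have hb0 : ∀ n, 0 ≤ ∫ p, g (Y n p) ∂ν n := fun n => integral_nonneg fun p => hg0 _
    have hb_le : ∀ n, ENNReal.ofReal (∫ p, g (Y n p) ∂ν n) ≤ ν n {p | δ / 2 < Y n p} := by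
      intro n
      have h1 : ENNReal.ofReal (∫ p, g (Y n p) ∂ν n) ≤ ∫⁻ p, ENNReal.ofReal (g (Y n p)) ∂ν n := by
        by_cases hf : Integrable (fun p => g (Y n p)) (ν n)
        · rw [ofReal_integral_eq_lintegral_ofReal hf (Eventually.of_forall fun p => hg0 _)]
        · rw [integral_undef hf, ENNReal.ofReal_zero]
          exact zero_le
      refine h1.trans ((lintegral_mono fun p => ?_).trans (lintegral_indicator_one_le _))
      by_cases hp : δ / 2 < Y n p
      · rw [Set.indicator_of_mem (show p ∈ {p | δ / 2 < Y n p} from hp), Pi.one_apply]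
        exact ENNReal.ofReal_le_one.2 (hg1 _)
      · rw [Set.indicator_of_notMem (show p ∉ {p | δ / 2 < Y n p} from hp),
          hgz _ (not_lt.1 hp), ENNReal.ofReal_zero]
    have hb : Tendsto (fun n => ∫ p, g (Y n p) ∂ν n) atTop (𝓝 0) := by
      have h1 : Tendsto (fun n => ENNReal.ofReal (∫ p, g (Y n p) ∂ν n)) atTop (𝓝 0) :=
        tendsto_of_tendsto_of_tendsto_of_le_of_le tendsto_const_nhds (hY _ (half_pos hδ))
          (fun n => zero_le) hb_le
      exact ((ENNReal.tendsto_toReal_zero_iff (fun n => ENNReal.ofReal_ne_top)).2 h1).congr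
        fun n => ENNReal.toReal_ofReal (hb0 n)
    have ha : Tendsto (fun n => ∫ z, g (X n z) ∂μ n) atTop (𝓝 0) := by
      simpa using (hswap g hgl hga).add hb
    have hA : ∀ n, MeasurableSet {z | δ < X n z} :=
      fun n => measurableSet_lt measurable_const (hX n)
    have ha_ge : ∀ n, min 1 (δ / 2) * (μ n {z | δ < X n z}).toReal ≤ ∫ z, g (X n z) ∂μ n := by
      intro n
      haveI := hμ n
      have hint : Integrable (fun z => g (X n z)) (μ n) :=
        Integrable.of_bound (hgl.continuous.measurable.comp (hX n)).aestronglyMeasurable 1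
          (Eventually.of_forall fun z => by rw [Real.norm_eq_abs]; exact hga (X n z))
      calc min 1 (δ / 2) * (μ n {z | δ < X n z}).toReal
          = ∫ z, {z | δ < X n z}.indicator (fun _ => min 1 (δ / 2)) z ∂μ n := by
            rw [integral_indicator_const _ (hA n), smul_eq_mul, measureReal_def, mul_comm]
        _ ≤ ∫ z, g (X n z) ∂μ n := by
            refine integral_mono ((integrable_const _).indicator (hA n)) hint fun z => ?_
            by_cases hz : δ < X n z
            · rw [Set.indicator_of_mem (show z ∈ {z | δ < X n z} from hz)]
              exact hgδ _ hz
            · rw [Set.indicator_of_notMem (show z ∉ {z | δ < X n z} from hz)]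
              exact hg0 _
    refine (ENNReal.tendsto_toReal_zero_iff fun n => ?_).1 ?_
    · haveI := hμ n
      exact measure_ne_top _ _
    have h0 : Tendsto (fun n => (min 1 (δ / 2))⁻¹ * ∫ z, g (X n z) ∂μ n) atTop (𝓝 0) := by
      simpa using ha.const_mul (min 1 (δ / 2))⁻¹
    refine tendsto_of_tendsto_of_tendsto_of_le_of_le tendsto_const_nhds h0
      (fun n => ENNReal.toReal_nonneg) fun n => ?_
    rw [le_inv_mul_iff₀ hκ]
    exact ha_ge n
  -- local Gibbs laws are finite for all `σ, N`: `1_D f₀^⊗(N+1)` integrable, or `𝒵 = 0` (zero law)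
  have aux : ∀ {α : Type} [MeasureSpace α] (f : α → ℝ) (s : Set α),
      ∫⁻ z in s, ENNReal.ofReal ((∫ z, f z)⁻¹ * f z) < ⊤ := by
    intro α _ f s
    by_cases hint : Integrable f volume
    · exact lt_of_le_of_lt (lintegral_mono' Measure.restrict_le_self fun z => Real.ofReal_le_enorm _)
        (hasFiniteIntegral_iff_enorm.1 (hint.const_mul _).hasFiniteIntegral)
    · simp [integral_undef hint]
  have hfinP : ∀ N, IsFiniteMeasure (Literature.MathematicalPhysics.KineticTheory.localGibbsLaw σ a₀ u₀ θ₀ N (Φ N)) := fun N =>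
    ⟨by
      show (volume.restrict _).withDensity _ Set.univ < ⊤
      rw [withDensity_apply _ MeasurableSet.univ, Measure.restrict_univ]
      exact aux _ _⟩
  -- measurability of the empirical fields (finite averages, `χ` continuous)
  have hpos : ∀ {N : ℕ} (i : Fin (N + 1)),
      Measurable fun z : Literature.Analysis.FluidPDE.Config (N + 1) (Fin 3) (UnitAddTorus (Fin 3)) => (z i).1 :=
    fun i => (measurable_pi_apply i).fst
  have hvel : ∀ {N : ℕ} (i : Fin (N + 1)),
      Measurable fun z : Literature.Analysis.FluidPDE.Config (N + 1) (Fin 3) (UnitAddTorus (Fin 3)) => (z i).2 :=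
    fun i => (measurable_pi_apply i).snd
  have hmD : ∀ N, Measurable fun z => Literature.MathematicalPhysics.KineticTheory.empiricalDensityField (N := N + 1) z χ := by
    intro N
    rw [show (fun z => Literature.MathematicalPhysics.KineticTheory.empiricalDensityField (N := N + 1) z χ) =
        fun z => ((N + 1 : ℕ) : ℝ)⁻¹ * ∑ i, χ (z i).1 from
      funext fun z => Literature.Analysis.FluidPDE.integral_empiricalMeasure z fun y => χ y.1]
    exact measurable_const.mul (Finset.measurable_sum _ fun i _ => hχ.measurable.comp (hpos i))
  have hmM : ∀ N, Measurable fun z => Literature.MathematicalPhysics.KineticTheory.empiricalMomentumField (N := N + 1) z χ := by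
    intro N
    have heq : (fun z => Literature.MathematicalPhysics.KineticTheory.empiricalMomentumField (N := N + 1) z χ) =
        fun z => (((N + 1 : ℕ) : ENNReal)⁻¹).toReal • ∑ i, χ (z i).1 • (z i).2 := by
      funext z
      show ∫ y, χ y.1 • y.2 ∂(Literature.Analysis.FluidPDE.empiricalMeasure z) = _
      rw [Literature.Analysis.FluidPDE.empiricalMeasure_eq, integral_smul_measure,
        integral_finsetSum_measure fun i _ => integrable_dirac enorm_lt_top]
      simp only [integral_dirac]
    rw [heq]
    exact (Finset.measurable_sum Finset.univ fun i _ =>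
      (hχ.measurable.comp (hpos i)).fun_smul (hvel i)).fun_const_smul _
  have hmE : ∀ N, Measurable fun z => Literature.MathematicalPhysics.KineticTheory.empiricalEnergyField (N := N + 1) z χ := by
    intro N
    rw [show (fun z => Literature.MathematicalPhysics.KineticTheory.empiricalEnergyField (N := N + 1) z χ) =
        fun z => ((N + 1 : ℕ) : ℝ)⁻¹ * ∑ i, χ (z i).1 * (‖(z i).2‖ ^ 2 / 2) from
      funext fun z => Literature.Analysis.FluidPDE.integral_empiricalMeasure z fun y => χ y.1 * (‖y.2‖ ^ 2 / 2)]
    exact measurable_const.mul (Finset.measurable_sum _ fun i _ =>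
      (hχ.measurable.comp (hpos i)).mul (((hvel i).norm.pow_const 2).div_const 2))
  -- `1`-Lipschitz maps do not increase distances; the elementary test functions
  have hdl : ∀ {α β : Type} [PseudoMetricSpace α] [PseudoMetricSpace β] (f : α → β),
      LipschitzWith 1 f → ∀ x y, dist (f x) (f y) ≤ dist x y :=
    fun f hf x y => by simpa using hf.dist_le_mul x y
  have habs : ∀ c : ℝ, LipschitzWith 1 fun x : ℝ => |x - c| :=
    fun c => by simpa only [Real.dist_eq] using LipschitzWith.dist_left c
  have hnrm : ∀ c : (EuclideanSpace ℝ (Fin 3)), LipschitzWith 1 fun x : (EuclideanSpace ℝ (Fin 3)) => ‖x - c‖ :=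
    fun c => by simpa only [dist_eq_norm] using LipschitzWith.dist_left c
  -- the three transfers (density, momentum, energy)
  refine ⟨?_, ?_, ?_⟩
  · exact key _ _ hfinP
      (fun N z => |Literature.MathematicalPhysics.KineticTheory.empiricalDensityField ((Φ N).flow t z) χ - ∫ x, χ x * ρ t x|) _
      (fun N => (((hmD N).comp ((Φ N).measurable_flow t)).sub measurable_const).abs)
      (fun g hg hg1 => hSw (fun y => g |y.1 - _|) (LipschitzWith.mk_one fun y y' =>
        (hdl g hg _ _).trans <| (hdl _ (habs _) _ _).trans (hdl _ LipschitzWith.prod_fst y y'))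
        fun y => hg1 _)
      (fun δ' hδ' => (hLa δ' hδ').1) δ hδ
  · exact key _ _ hfinP
      (fun N z => ‖Literature.MathematicalPhysics.KineticTheory.empiricalMomentumField ((Φ N).flow t z) χ - ∫ x, (χ x * ρ t x) • u t x‖) _
      (fun N => (((hmM N).comp ((Φ N).measurable_flow t)).sub measurable_const).norm)
      (fun g hg hg1 => hSw (fun y => g ‖y.2.1 - _‖) (LipschitzWith.mk_one fun y y' =>
        (hdl g hg _ _).trans <| (hdl _ (hnrm _) _ _).trans <|
          (hdl _ LipschitzWith.prod_fst y.2 y'.2).trans (hdl _ LipschitzWith.prod_snd y y'))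
        fun y => hg1 _)
      (fun δ' hδ' => (hLa δ' hδ').2.1) δ hδ
  · exact key _ _ hfinP (fun N z => |Literature.MathematicalPhysics.KineticTheory.empiricalEnergyField ((Φ N).flow t z) χ -
        ∫ x, χ x * Literature.MathematicalPhysics.KineticTheory.totalEnergyDensity (ρ t x) (u t x) (θ t x)|) _
      (fun N => (((hmE N).comp ((Φ N).measurable_flow t)).sub measurable_const).abs)
      (fun g hg hg1 => hSw (fun y => g |y.2.2 - _|) (LipschitzWith.mk_one fun y y' =>
        (hdl g hg _ _).trans <| (hdl _ (habs _) _ _).trans <|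
          (hdl _ LipschitzWith.prod_snd y.2 y'.2).trans (hdl _ LipschitzWith.prod_snd y y'))
        fun y => hg1 _)
      (fun δ' hδ' => (hLa δ' hδ').2.2) δ hδ

/-- **THE RE-GLUED DECIDING THEOREM**: `SwapGap → LambertianEulerInBand → HydrodynamicLimit` — the route decides the
(packing-guarded) conjunct from the derandomisation gap and the GUARDED Euler limit of the Lambertian gas; the expected-false leaf
`DiluteSelfConsistency` of the unguarded crux is not needed. [cite: Billingsley1999, Thm 2.1] [cite: OllaVaradhanYau1993, §1] -/
theorem hydrodynamicLimit_of_swapGap_of_inBand (hS : SwapGap) (hL : LambertianEulerInBand) : _root_.HydrodynamicLimit :=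
  hydrodynamicLimit_of_swapGap_of_inBandInline hS (inline_of_named hL)

end Summit.AtomisticToContinuum.HydrodynamicLimit.Theorems.LambertianContactSwapLambertianEulerInBandCloses
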